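import Mathlib
import Summits.Ventures.PercRepro2.Tail2DBlockCalc
import Summits.Ventures.PercRepro2.Tail2DHarrisSP
import Summits.Ventures.PercRepro2.Tail2DFlowOneBlocks
import Summits.Ventures.PercRepro2.Tail2DFlowOnePar
import Summits.Ventures.PercRepro2.Tail2DFlowOneStep01
import Summits.Ventures.PercRepro2.Tail2DFlowOneThreeCounts
import Summits.Ventures.PercRepro2.Tail2DFlowOneAxis
import Summits.Ventures.PercRepro2.Tail2DParFin
import Summits.Ventures.PercRepro2.Tail2DSDomSwap

/-!
# Columns `{r = j}` of a network and of `X ∥ Y` for a flow-one `X`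
(seat mine-b, cell pub-perc-repro2; conjectures/MINE-B.md §45.10)

`colAt Y j = {r = j}` with count `colCount Y j`; on `X ∥ Y` with `X` flow-one,
`colAt (X ∥ Y) (i+1) = R × colAt Y i ⊔ col × colAt Y (i+1)`, `colAt (X ∥ Y) 0 = col × colAt Y 0`, with the
counts `C'_{i+1} = a C_i + (n − a) C_{i+1}`, `C'_0 = (n − a) C_0` — the blocks of the column relay
(`Tail2DRelayCol.lean`).
-/

namespace Summit.Ventures.PercRepro2.Tail2D

open V2Closure Finset

section Columns

variable (Y : V2Closure.SP)

/-- the column `{r = j}` -/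
def colAt (j : ℕ) : Finset Y.Conf := Finset.univ.filter (fun y : Y.Conf => Y.rLab y = j)

/-- membership in a column -/
theorem mem_colAt (j : ℕ) (y : Y.Conf) : y ∈ colAt Y j ↔ Y.rLab y = j := by
  simp [colAt]

/-- the column counts -/
def colCount (j : ℕ) : ℕ := (colAt Y j).card

/-- the cardinality of a column is its count -/
theorem card_colAt (j : ℕ) : (colAt Y j).card = colCount Y j := rfl

variable (X : V2Closure.SP)

/-- the red label of a parallel composition adds -/
theorem rLab_par_pair (x : X.Conf) (y : Y.Conf) :
    (V2Closure.SP.par X Y).rLab ((x, y) : X.Conf × Y.Conf) = X.rLab x + Y.rLab y := rfl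

/-- the uniform density of a column -/
theorem unifDens_colAt (j : ℕ) (z : Y.Conf) :
    unifDens Y (colAt Y j) z = if Y.rLab z = j then ((colCount Y j : ℕ) : ℚ)⁻¹ else 0 := by
  unfold unifDens colCount
  by_cases h : Y.rLab z = j
  · rw [if_pos ((mem_colAt Y j z).2 h), if_pos h]
  · rw [if_neg (fun hm => h ((mem_colAt Y j z).1 hm)), if_neg h]

/-- the column `{r = i+1}` of `X ∥ Y` for flow-one `X`: `R × colAt Y i ⊔ col × colAt Y (i+1)` -/
theorem colAt_par_succ (hX : FlowOne X) (i : ℕ) :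
    colAt (V2Closure.SP.par X Y) (i + 1)
      = ((rSet X ×ˢ colAt Y i : Finset (X.Conf × Y.Conf)) ∪ (colSet X ×ˢ colAt Y (i + 1) : Finset (X.Conf × Y.Conf))) := by
  apply Finset.ext; intro p
  rw [mem_colAt]
  refine Iff.trans ?_ Finset.mem_union.symm
  refine Iff.trans ?_ (or_congr Finset.mem_product Finset.mem_product).symm
  rw [mem_rSet, mem_colSet, mem_colAt, mem_colAt]
  show X.rLab p.1 + Y.rLab p.2 = i + 1 ↔ _
  have := hX p.1
  omega

/-- the column `{r = 0}` of `X ∥ Y`: `col × colAt Y 0` -/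
theorem colAt_par_zero (hX : FlowOne X) :
    colAt (V2Closure.SP.par X Y) 0 = (colSet X ×ˢ colAt Y 0 : Finset (X.Conf × Y.Conf)) := by
  apply Finset.ext; intro p
  rw [mem_colAt]
  refine Iff.trans ?_ Finset.mem_product.symm
  rw [mem_colSet, mem_colAt]
  show X.rLab p.1 + Y.rLab p.2 = 0 ↔ _
  have := hX p.1
  omega

/-- `C'_{i+1} = a C_i + (n − a) C_{i+1}` -/
theorem colCount_par_succ (hX : FlowOne X) (i : ℕ) :
    colCount (V2Closure.SP.par X Y) (i + 1)
      = (rSet X).card * colCount Y i + (Fintype.card X.Conf - (rSet X).card) * colCount Y (i + 1) := by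
  unfold colCount
  rw [colAt_par_succ Y X hX i]
  show ((rSet X ×ˢ colAt Y i : Finset (X.Conf × Y.Conf)) ∪ (colSet X ×ˢ colAt Y (i + 1) : Finset (X.Conf × Y.Conf))).card = _
  rw [Finset.card_union_of_disjoint, Finset.card_product, Finset.card_product, card_colSet X hX]
  rw [Finset.disjoint_left]
  intro p h1 h2
  rw [Finset.mem_product, mem_rSet] at h1
  rw [Finset.mem_product, mem_colSet] at h2
  omega

/-- `C'_0 = (n − a) C_0` -/
theorem colCount_par_zero (hX : FlowOne X) :
    colCount (V2Closure.SP.par X Y) 0 = (Fintype.card X.Conf - (rSet X).card) * colCount Y 0 := by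
  unfold colCount
  rw [colAt_par_zero Y X hX]
  show (colSet X ×ˢ colAt Y 0 : Finset (X.Conf × Y.Conf)).card = _
  rw [Finset.card_product, card_colSet X hX]

end Columns

end Summit.Ventures.PercRepro2.Tail2D
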